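import Mathlib
import HarnessLib
import Summits.HubbardSuperconductivity.HubbardSuperconductivity.Theorems.KLProgrammeKLRegimeSplitFieldStrengthSectorTelescope
import Summits.HubbardSuperconductivity.HubbardSuperconductivity.Theorems.KLProgrammeKLRegimeEngineTwoLegBudgetDecay

/-!
# Route `KLProgramme` — ENGINE child gen 8 (stmt-HubbardSuperconductivity-20437 `KLRegimeEngineV17F2`), class #7 / (E3d) in sector-pinned currency:
# AT MOST TWO SECTORS SEE A MOMENTUM — `#{ω : F_{j,ω}(ω₀,k⃗) ≠ 0} ≤ 2` — and the time row with a UNIFORM per-scale bound, `|z_n − 1| ≤ |z_0 − 1| + 4·Σ_{j<n} M̄_j`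
# (cell gate-hubbard-kl, seat hubbard-kl-k3c2-p3 g8; memo W3-CURRENCY.md §4(c); sector counting at its most elementary)

WHY.  `…SplitFieldStrengthSectorTelescope` bounds `|z_n(K)(k⃗) − 1|` by `|z_0(K)(k⃗) − 1| + 2·Σ_{j<n} Σ_{ω ∈ A_{s j}(k⃗)} Mt j ω` with
`A_j(k⃗) = {ω : F_{j,ω}(ω₀,k⃗) ≠ 0}` the sectors of the scale-`j` anisotropic family that see the read-out momentum.  A supplier (the tower's part 10-L)
delivers a bound UNIFORM in the pinned sector, `Mt j ω ≤ M̄_j`; what turns `Σ_{ω∈A}` into a constant is the SIZE of `A`.  For BGM's angular partition of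
unity (`sectorWeightCirc`: profile supported in `|r| < 3/4` around the centres `(ω + ½)w_n`, consecutive centres `w_n` apart, `N·w_n = 2π`) every angle
lies in the support of AT MOST TWO of the `N = 2^{n+1}` circle weights:

* `sectorWeight_ne_zero_imp` — `ζ_{n,m}(θ) ≠ 0 ⟹ |θ/w_n − ½ − m| < 3/4`;
* `sectorWeightCirc_ne_zero_imp` — `ζ̃_{n,ω}(θ) ≠ 0 ⟹ ∃ k, |θ/w_n − ½ − (ω + kN)| < 3/4`;
* **`card_filter_sectorWeightCirc_ne_zero_le_two`** — `#{ω < N : ζ̃_{n,ω}(θ) ≠ 0} ≤ 2` (the integers `ω + kN` are distinct for distinct `ω < N` and all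
  lie in `{⌊θ/w_n − ¼⌋, ⌊θ/w_n − ¼⌋ + 1}`);
* **`card_filter_klAnisoFamily_ne_zero_le_two`** — `#A_j(k⃗) ≤ 2` for the cell's families (`bgmMultiplier = cutoff · ζ̃`);
* **`abs_klFieldStrength_sub_one_le_telescope_of_deep_uniform`** — with `Mt j ω ≤ M̄ j` (`0 ≤ M̄ j`):
  `|z_n(K)(k⃗) − 1| ≤ |z_0(K)(k⃗) − 1| + 4·Σ_{j<n} M̄ j`; with `M̄ j ≤ C·ε_j²·2^{−j}` this is `≤ |z_0 − 1| + 48·C·Klam²·U²` uniformly in `n`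
  (`abs_klFieldStrength_sub_one_le_of_deep_decay`, via `EngineV8.sum_le_of_le_epsCoupling_sq_decay`).

Everything is PROVED; no definitions; nothing about the model is asserted.
References: BGM 2006 §2.5 (2.45)–(2.46) [cite: BenfattoGiulianiMastropietro2006].
-/

noncomputable section

namespace Summit.HubbardSuperconductivity.HubbardSuperconductivity.Theorems.TwoLegFourier

set_option linter.dupNamespace false -- summit = problem name (single-conjunct summit), D-0017

open Finset Complex
open Literature.MathematicalPhysics.QuantumLattice Literature.Probability.LatticeModels GrassmannAlgebra
open Summit.HubbardSuperconductivity.HubbardSuperconductivity.Theorems.KLRegimeSplit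

/-! ## §1 At most two circle weights are non-zero at any angle -/

/-- Support of a line weight: `ζ_{n,m}(θ) ≠ 0 ⟹ |θ/w_n − ½ − m| < 3/4`. -/
theorem sectorWeight_ne_zero_imp {n : ℕ} {m : ℤ} {θ : ℝ} (h : sectorWeight n m θ ≠ 0) :
    |θ / sectorWidth n - 1 / 2 - m| < 3 / 4 := by
  by_contra hge
  apply h
  rw [sectorWeight]
  apply sectorUnitWeight_eq_zero
  rw [show θ / sectorWidth n - m - 1 / 2 = θ / sectorWidth n - 1 / 2 - m by ring]
  exact le_of_not_gt hge

/-- Support of a circle weight: `ζ̃_{n,ω}(θ) ≠ 0 ⟹ ∃ k, |θ/w_n − ½ − (ω + kN)| < 3/4`. -/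
theorem sectorWeightCirc_ne_zero_imp {n : ℕ} {ω : ℤ} {θ : ℝ} (h : sectorWeightCirc n ω θ ≠ 0) :
    ∃ k : ℤ, |θ / sectorWidth n - 1 / 2 - ((ω + k * sectorCount n : ℤ) : ℝ)| < 3 / 4 := by
  by_contra hall
  push Not at hall
  apply h
  rw [sectorWeightCirc]
  have hz : ∀ k : ℤ, sectorWeight n (ω + k * sectorCount n) θ = 0 := fun k => by
    by_contra hk
    exact absurd (sectorWeight_ne_zero_imp hk) (not_lt.2 (hall k))
  simp only [hz, tsum_zero]

/-- Two integers within `3/4` of the same real number lie in a fixed two-element set: `|r − m| < 3/4 ⟹ m ∈ {⌊r + 1/4⌋, ⌊r + 1/4⌋ + 1}`. [folklore] -/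
theorem int_mem_pair_of_abs_sub_lt {r : ℝ} {m : ℤ} (h : |r - m| < 3 / 4) :
    m ∈ ({⌊r + 1 / 4⌋, ⌊r + 1 / 4⌋ + 1} : Finset ℤ) := by
  rw [abs_lt] at h
  obtain ⟨h1, h2⟩ := h
  have hlo : ⌊r + 1 / 4⌋ ≤ m := by
    rw [Int.floor_le_iff]
    linarith
  have hhi : m ≤ ⌊r + 1 / 4⌋ + 1 := by
    have : (m : ℝ) < r + 3 / 4 := by linarith
    have h' : m ≤ ⌊r + 5 / 4⌋ := Int.le_floor.2 (by linarith)
    have h'' : ⌊r + 5 / 4⌋ = ⌊r + 1 / 4⌋ + 1 := by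
      rw [show r + 5 / 4 = r + 1 / 4 + 1 by ring, Int.floor_add_one]
    omega
  rw [mem_insert, mem_singleton]
  omega

/-- **AT MOST TWO CIRCLE WEIGHTS SEE AN ANGLE**: `#{ω < N : ζ̃_{n,ω}(θ) ≠ 0} ≤ 2`. [cite: BenfattoGiulianiMastropietro2006, §2.5 (2.45)] -/
theorem card_filter_sectorWeightCirc_ne_zero_le_two (n : ℕ) (θ : ℝ) :
    (univ.filter (fun ω : Fin (sectorCount n) => sectorWeightCirc n (ω : ℤ) θ ≠ 0)).card ≤ 2 := by
  classical
  set r : ℝ := θ / sectorWidth n - 1 / 2 with hr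
  set T : Finset ℤ := {⌊r + 1 / 4⌋, ⌊r + 1 / 4⌋ + 1} with hT
  -- the representative `ω + k_ω N` of a contributing label
  let f : Fin (sectorCount n) → ℤ := fun ω =>
    if h : sectorWeightCirc n (ω : ℤ) θ ≠ 0 then (ω : ℤ) + Classical.choose (sectorWeightCirc_ne_zero_imp h) * sectorCount n else 0
  have hf : ∀ ω ∈ univ.filter (fun ω : Fin (sectorCount n) => sectorWeightCirc n (ω : ℤ) θ ≠ 0), f ω ∈ T := by
    intro ω hω
    have h := (mem_filter.1 hω).2
    have hspec := Classical.choose_spec (sectorWeightCirc_ne_zero_imp h)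
    simp only [f, dif_pos h]
    exact int_mem_pair_of_abs_sub_lt hspec
  have hinj : Set.InjOn f (univ.filter (fun ω : Fin (sectorCount n) => sectorWeightCirc n (ω : ℤ) θ ≠ 0) : Set (Fin (sectorCount n))) := by
    intro ω hω ω' hω' heq
    have h := (mem_filter.1 (Finset.mem_coe.1 hω)).2
    have h' := (mem_filter.1 (Finset.mem_coe.1 hω')).2
    simp only [f, dif_pos h, dif_pos h'] at heq
    have hN : (0 : ℤ) < sectorCount n := by exact_mod_cast sectorCount_pos n
    have hmod := congrArg (fun z : ℤ => z % (sectorCount n : ℤ)) heq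
    simp only [Int.add_mul_emod_self_right] at hmod
    rw [Int.emod_eq_of_lt (by positivity) (by exact_mod_cast ω.isLt), Int.emod_eq_of_lt (by positivity) (by exact_mod_cast ω'.isLt)] at hmod
    exact Fin.ext (by exact_mod_cast hmod)
  calc (univ.filter (fun ω : Fin (sectorCount n) => sectorWeightCirc n (ω : ℤ) θ ≠ 0)).card ≤ T.card :=
        Finset.card_le_card_of_injOn f hf hinj
    _ ≤ 2 := by rw [hT]; exact (card_insert_le _ _).trans (by simp)

/-! ## §2 The cell's anisotropic family: at most two sectors see `(ω₀, k⃗)` -/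

section Model

open Summit.HubbardSuperconductivity.HubbardSuperconductivity.Theorems.KLProgrammeLegKernels

variable {L M : ℕ}

/-- A non-zero anisotropic multiplier has a non-zero angular factor. -/
theorem sectorWeightCirc_ne_zero_of_klAnisoFamily_ne_zero [NeZero L] (β μ : ℝ) (K : TrigPolyC4v) (e₀ : ℝ) (j : ℕ)
    {ω : Fin (sectorCount j)} {q : FreqMomentum L M} (h : klAnisoFamily L M β μ K e₀ j ω q ≠ 0) :
    sectorWeightCirc j (ω : ℤ) (momentumAngle L q.2) ≠ 0 := by
  intro hz
  apply h
  simp only [klAnisoFamily, bgmMultiplier, hz, mul_zero, Complex.ofReal_zero]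

/-- **`#A_j(k⃗) ≤ 2`**: at most two sectors of the scale-`j` anisotropic family see a given frequency–momentum. -/
theorem card_filter_klAnisoFamily_ne_zero_le_two [NeZero L] (β μ : ℝ) (K : TrigPolyC4v) (e₀ : ℝ) (j : ℕ) (q : FreqMomentum L M) :
    (univ.filter (fun ω : Fin (sectorCount j) => klAnisoFamily L M β μ K e₀ j ω q ≠ 0)).card ≤ 2 := by
  classical
  refine le_trans (card_le_card (fun ω hω => ?_)) (card_filter_sectorWeightCirc_ne_zero_le_two j (momentumAngle L q.2))
  rw [mem_filter] at hω ⊢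
  exact ⟨hω.1, sectorWeightCirc_ne_zero_of_klAnisoFamily_ne_zero β μ K e₀ j hω.2⟩

/-- A sum of terms `≤ B` (`0 ≤ B`) over the (at most two) sectors seeing `q` is `≤ 2B`. -/
theorem sum_filter_klAnisoFamily_ne_zero_le_two_mul [NeZero L] (β μ : ℝ) (K : TrigPolyC4v) (e₀ : ℝ) (j : ℕ) (q : FreqMomentum L M)
    {g : Fin (sectorCount j) → ℝ} {B : ℝ} (hB : 0 ≤ B)
    (hg : ∀ ω ∈ univ.filter (fun ω : Fin (sectorCount j) => klAnisoFamily L M β μ K e₀ j ω q ≠ 0), g ω ≤ B) :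
    ∑ ω ∈ univ.filter (fun ω : Fin (sectorCount j) => klAnisoFamily L M β μ K e₀ j ω q ≠ 0), g ω ≤ 2 * B := by
  calc ∑ ω ∈ univ.filter (fun ω : Fin (sectorCount j) => klAnisoFamily L M β μ K e₀ j ω q ≠ 0), g ω
      ≤ ∑ _ω ∈ univ.filter (fun ω : Fin (sectorCount j) => klAnisoFamily L M β μ K e₀ j ω q ≠ 0), B := sum_le_sum hg
    _ = (univ.filter (fun ω : Fin (sectorCount j) => klAnisoFamily L M β μ K e₀ j ω q ≠ 0)).card * B := by
        rw [sum_const, nsmul_eq_mul]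
    _ ≤ 2 * B := by
        have h := card_filter_klAnisoFamily_ne_zero_le_two (L := L) (M := M) β μ K e₀ j q
        exact mul_le_mul_of_nonneg_right (by exact_mod_cast h) hB

/-! ## §3 The time row with a uniform per-scale bound -/

/-- **THE TIME ROW OF CLASS #7, SECTOR-PINNED, UNIFORM PER-SCALE BOUND**: under the hypotheses of `abs_klFieldStrength_sub_one_le_telescope_of_deep` with
sector-pinned temporal first moments of the `j`-th increment bounded UNIFORMLY in the pinned sector, `≤ M̄ j` (`0 ≤ M̄ j`), one has
`|z_n(K)(k⃗) − 1| ≤ |z_0(K)(k⃗) − 1| + 4·Σ_{j<n} M̄ j`. [cite: BenfattoGiulianiMastropietro2006, (2.36), §3 (3.6)] -/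
theorem abs_klFieldStrength_sub_one_le_telescope_of_deep_uniform [NeZero L] [NeZero M] {β : ℝ} (hβ : 0 < β) (U μ : ℝ) (K : TrigPolyC4v)
    (k : TorusSite 2 L) {n : ℕ} (s : ℕ → ℕ)
    (hdeep : ∀ j < n, Real.sqrt ((Real.pi / β) ^ 2 + nambuXiCT L μ K k ^ 2) ≤ klScale klE0 (s j + 1))
    {Mbar : ℕ → ℝ} (hMbar0 : ∀ j < n, 0 ≤ Mbar j)
    (hMt : ∀ j < n, ∀ (σ : Fin 2),
      ∀ ω ∈ univ.filter (fun ω : Fin (sectorCount (s j)) => klAnisoFamily L M β μ K klE0 (s j) ω (omega0 M, k) ≠ 0),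
      ∀ x₀ : SpaceTimeIdx L M, imagTimeWeight β M *
      ∑ x ∈ (univ : Finset (Fin 2 → SpaceTimeIdx L M)).filter (fun x => x 0 = x₀),
        ∑ ω' ∈ univ.filter (fun ω : Fin (sectorCount (s j)) => klAnisoFamily L M β μ K klE0 (s j) ω (omega0 M, k) ≠ 0),
        imagTimeWeight β M * (circDist (2 * M) (x 0).1.val (x 1).1.val : ℝ) *
          ‖sectorisedKernel L M β (klAnisoFamily L M β μ K klE0 (s j))
              (klEffectiveAction L M β U μ K klE0 (j + 1) - klEffectiveAction L M β U μ K klE0 j) 2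
              (![((ω, σ), 0), ((ω', σ), 1)] : Fin 2 → SectorLeg (sectorCount (s j))) x‖ ≤ Mbar j) :
    |klFieldStrength L M β U μ K n k - 1| ≤ |klFieldStrength L M β U μ K 0 k - 1| + 4 * ∑ j ∈ range n, Mbar j := by
  have h := abs_klFieldStrength_sub_one_le_telescope_of_deep (L := L) (M := M) hβ U μ K k s hdeep
    (Mt := fun j _ => Mbar j) hMt
  refine h.trans ?_
  have hsum : ∑ j ∈ range n, ∑ ω ∈ univ.filter (fun ω : Fin (sectorCount (s j)) => klAnisoFamily L M β μ K klE0 (s j) ω (omega0 M, k) ≠ 0),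
      (fun (j : ℕ) (_ : Fin (sectorCount (s j))) => Mbar j) j ω ≤ ∑ j ∈ range n, 2 * Mbar j :=
    sum_le_sum fun j hj => sum_filter_klAnisoFamily_ne_zero_le_two_mul β μ K klE0 (s j) (omega0 M, k) (hMbar0 j (mem_range.1 hj))
      (fun _ _ => le_rfl)
  rw [← mul_sum] at hsum
  linarith

/-- **THE TIME ROW, n-FREE AND `O(U²)`**: if moreover `M̄ j ≤ C·ε_j²·(2^j)⁻¹` (`C ≥ 0`, `|U| ≤ 1`) — the two-leg improvement of the curved Fermi curve,
one factor `2^{−j}` per scale — then `|z_n(K)(k⃗) − 1| ≤ |z_0(K)(k⃗) − 1| + 48·C·Klam²·U²`, uniformly in the depth `n`. -/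
theorem abs_klFieldStrength_sub_one_le_of_deep_decay [NeZero L] [NeZero M] {β : ℝ} (hβ : 0 < β) {U : ℝ} (hU : |U| ≤ 1) (μ : ℝ)
    (K : TrigPolyC4v) (P : SplitConsts) {C : ℝ} (hC : 0 ≤ C) (k : TorusSite 2 L) {n : ℕ} (s : ℕ → ℕ)
    (hdeep : ∀ j < n, Real.sqrt ((Real.pi / β) ^ 2 + nambuXiCT L μ K k ^ 2) ≤ klScale klE0 (s j + 1))
    {Mbar : ℕ → ℝ} (hMbar0 : ∀ j < n, 0 ≤ Mbar j) (hMbar : ∀ j < n, Mbar j ≤ C * (epsCoupling P U j ^ 2 * ((2 : ℝ) ^ j)⁻¹))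
    (hMt : ∀ j < n, ∀ (σ : Fin 2),
      ∀ ω ∈ univ.filter (fun ω : Fin (sectorCount (s j)) => klAnisoFamily L M β μ K klE0 (s j) ω (omega0 M, k) ≠ 0),
      ∀ x₀ : SpaceTimeIdx L M, imagTimeWeight β M *
      ∑ x ∈ (univ : Finset (Fin 2 → SpaceTimeIdx L M)).filter (fun x => x 0 = x₀),
        ∑ ω' ∈ univ.filter (fun ω : Fin (sectorCount (s j)) => klAnisoFamily L M β μ K klE0 (s j) ω (omega0 M, k) ≠ 0),
        imagTimeWeight β M * (circDist (2 * M) (x 0).1.val (x 1).1.val : ℝ) *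
          ‖sectorisedKernel L M β (klAnisoFamily L M β μ K klE0 (s j))
              (klEffectiveAction L M β U μ K klE0 (j + 1) - klEffectiveAction L M β U μ K klE0 j) 2
              (![((ω, σ), 0), ((ω', σ), 1)] : Fin 2 → SectorLeg (sectorCount (s j))) x‖ ≤ Mbar j) :
    |klFieldStrength L M β U μ K n k - 1| ≤ |klFieldStrength L M β U μ K 0 k - 1| + 48 * C * P.Klam ^ 2 * U ^ 2 := by
  have h := abs_klFieldStrength_sub_one_le_telescope_of_deep_uniform (L := L) (M := M) hβ U μ K k s hdeep hMbar0 hMt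
  have hs := EngineV8.sum_le_of_le_epsCoupling_sq_decay P hU hC hMbar
  linarith

end Model

end Summit.HubbardSuperconductivity.HubbardSuperconductivity.Theorems.TwoLegFourier

end
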